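import Summits.CriticalPhenomena.SAWScalingLimit.Theorems.SAWRenewalTightnessTubeLowerBoundDefs
import Literature.Probability.RandomPlanarGeometry.SAWBridges

/-!
# Crux `SAWRenewalTightness.TubeLowerBound` (stmt-CriticalPhenomena-4730), line `lieb-simon-star`:
hardness links for the open stub S1 and for the crux

Two elementary implications recording what the open statements ENTAIL (lead c1,
prover-line-stmt-CriticalPhenomena-4730-c1-0, 2026-08-16), so that their standing can be read off the
literature:

* `bridgeSpanFloor_of_cornerCrossingFloor` — the open stub S1 `CornerCrossingFloor` (corner-started,
  rectangle-confined corner-to-column `x_c`-mass `≥ c a^{-C}`) implies a POINTWISE POLYNOMIAL FLOOR FOR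
  BRIDGES BY SPAN at the critical fugacity: for every `L ≥ 1` some partial sum of
  `B_{x_c}(L) = Σ_{bridges ω : 0 → column L} x_c^{|ω|}` is `≥ c' L^{-C}`.  Mechanism: one east edge
  prepended to a corner-crossing walk of width `a` is a bridge of span `a + 1` (Madras–Slade Definition
  1.2.4), and the map is a weight-`x_c` injection.  What is in print about `B_{x_c}(L)`: `B_{x_c}(L) ≤ 1`
  (Kesten's renewal bound, the tree's `StripMassConservation`), `Σ_L B_{x_c}(L) = ∞` and hence only the
  SUBEXPONENTIAL lower bound `B_{x_c}(L) = e^{-o(L)}` (`M(z_c) = 0`, Madras–Slade Theorem 4.1.13);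
  a polynomial floor is not in print for `ℤ²` (conjecturally `B_{x_c}(L) ≍ L^{-1/4}`).
* `stripTwoPointFloor_of_tubeLowerBound` — the crux itself implies a pointwise polynomial floor for the
  critical two-point function CONFINED TO A STRIP whose width is a fixed fraction of the distance:
  `Σ_{ω : 0 → (L,0), all |y| ≤ L/10 + 2} x_c^{|ω|} ≥ c L^{-C}` (some partial sum), for every `L ≥ 1`.
  (Madras–Slade p. 77: at `z_c` not even the finiteness of `G_{z_c}(0,x)` is known in `d = 2,3,4`; the
  landed `DominoFloor` gives the unconfined-in-aspect axis floor `≥ x_c/(16(2R+1))` in the fat domino, the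
  strip version is the boundary-regime statement the crux adds.)

No definitions; statements over tree vocabulary (`Zd.saws`, `Zd.bridges`, `Zd.sawFun`, `criticalFugacity`).
-/

noncomputable section

namespace Summit.CriticalPhenomena.SAWScalingLimit.Theorems.TubeLowerBound.LiebSimonStar

open scoped BigOperators Classical
open Literature.Probability.LatticeModels
open Literature.Probability.RandomPlanarGeometry Literature.Probability.RandomPlanarGeometry.SAW
open Summit.CriticalPhenomena.SAWScalingLimit.Theses.SAWRenewalTightness (TubeLowerBound)

namespace Hardness

/-! ### Prepending one east edge turns a corner-crossing walk into a bridge -/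

/-- Values of the prepended walk `concatWalk 1 (straightWalk 2 1) ω` after the first step:
`e₁ + ω j` at time `1 + j` (for a walk `ω` from `0`). -/
theorem pre_apply_one_add {ω : ℕ → Site 2} (hω0 : ω 0 = 0) (j : ℕ) :
    Zd.concatWalk 1 (Zd.straightWalk 2 1) ω (1 + j) = Pi.single 0 1 + ω j := by
  have e1 : Zd.straightWalk 2 1 1 = Pi.single 0 1 := by simp [Zd.straightWalk]
  simp only [Zd.concatWalk]
  rcases Nat.eq_zero_or_pos j with rfl | hj
  · simp [e1, hω0]
  · rw [if_neg (by omega), show 1 + j - 1 = j by omega, e1]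

/-- The prepended walk starts at `0`. -/
theorem pre_apply_zero (ω : ℕ → Site 2) : Zd.concatWalk 1 (Zd.straightWalk 2 1) ω 0 = 0 := by
  simp [Zd.concatWalk, Zd.straightWalk]

/-- First coordinate of the prepended walk after the first step: `1 + ω j 0`. -/
theorem pre_apply_one_add_zero {ω : ℕ → Site 2} (hω0 : ω 0 = 0) (j : ℕ) :
    Zd.concatWalk 1 (Zd.straightWalk 2 1) ω (1 + j) 0 = 1 + ω j 0 := by
  simp [pre_apply_one_add hω0]

/-- The prepended walk is self-avoiding when `ω` stays in the closed right half-plane `x ≥ 0`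
(column separation). -/
theorem pre_mem_saws {n : ℕ} {ω : ℕ → Site 2} (hω : ω ∈ Zd.saws 2 n) (hx : ∀ j ≤ n, 0 ≤ ω j 0) :
    Zd.concatWalk 1 (Zd.straightWalk 2 1) ω ∈ Zd.saws 2 (1 + n) := by
  obtain ⟨hω0, -, -, hinj⟩ := Zd.mem_saws.1 hω
  have e1 : ∀ i ≤ 1, Zd.straightWalk 2 1 i 0 = i := fun i hi => by
    simp [Zd.straightWalk, min_eq_left hi]
  refine Zd.concatWalk_mem_saws (Zd.straightWalk_mem_saws 2 1) hω fun i hi j hj1 hjn heq => ?_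
  rcases Nat.eq_zero_or_pos i with rfl | hipos
  · have h0 := congrFun heq 0
    simp only [Pi.add_apply, e1 0 (Nat.zero_le 1), e1 1 le_rfl, Nat.cast_zero, Nat.cast_one] at h0
    have := hx j hjn
    linarith
  · obtain rfl : i = 1 := by omega
    have hj0 : ω j = ω 0 := by
      rw [hω0]
      exact add_eq_left.1 heq.symm
    have := hinj (show j ≤ n from hjn) (Nat.zero_le n) hj0
    omega

/-- The prepended walk is a BRIDGE of span `ω n 0 + 1` when `ω` stays in the columns `0 ≤ x ≤ ω n 0`
(Madras–Slade Definition 1.2.4: `0 = x₀ < xᵢ ≤ x_{1+n}`). -/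
theorem pre_isBridge {n : ℕ} {ω : ℕ → Site 2} (hω : ω ∈ Zd.saws 2 n)
    (hx : ∀ j ≤ n, 0 ≤ ω j 0 ∧ ω j 0 ≤ ω n 0) :
    Zd.IsBridge (1 + n) (Zd.concatWalk 1 (Zd.straightWalk 2 1) ω) := by
  obtain ⟨hω0, -, -, -⟩ := Zd.mem_saws.1 hω
  intro i hi1 hin
  obtain ⟨j, rfl⟩ : ∃ j, i = 1 + j := ⟨i - 1, by omega⟩
  rw [pre_apply_zero, pre_apply_one_add_zero hω0, pre_apply_one_add_zero hω0]
  obtain ⟨h1, h2⟩ := hx j (by omega)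
  simp only [Pi.zero_apply]
  exact ⟨by linarith, by linarith⟩

/-- The prepending map is injective on walks from `0`. -/
theorem pre_injective {ω ω' : ℕ → Site 2} (hω0 : ω 0 = 0) (hω0' : ω' 0 = 0)
    (h : Zd.concatWalk 1 (Zd.straightWalk 2 1) ω = Zd.concatWalk 1 (Zd.straightWalk 2 1) ω') :
    ω = ω' := by
  funext j
  have := congrFun h (1 + j)
  rwa [pre_apply_one_add hω0, pre_apply_one_add hω0', add_right_inj] at this

/-- **Mass transfer.** `x_c` times the partial corner-crossing mass of the box `[0,a] × [lo,hi]`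
(walks from `0` confined to the box, last vertex on the column `x = a`) is at most the partial mass of
bridges ending on the column `x = a + 1`, one step later. -/
theorem criticalFugacity_mul_boxMass_le_bridgeMass (a N : ℕ) (lo hi : ℤ) :
    criticalFugacity * ∑ n ∈ Finset.range (N + 1), ∑ _ω ∈ (Zd.saws 2 n).filter (fun ω =>
        (∀ i ≤ n, 0 ≤ ω i 0 ∧ ω i 0 ≤ (a : ℤ) ∧ lo ≤ ω i 1 ∧ ω i 1 ≤ hi) ∧ ω n 0 = (a : ℤ)),
        criticalFugacity ^ n ≤
      ∑ n ∈ Finset.range (N + 2), ∑ _ω ∈ (Zd.bridges 2 n).filter (fun ω => ω n 0 = (a : ℤ) + 1),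
        criticalFugacity ^ n := by
  have hx0 : 0 ≤ criticalFugacity := criticalFugacity_pos.le
  -- termwise: the walks of length `n` inject into the bridges of length `1 + n`
  have step : ∀ n : ℕ, criticalFugacity * ∑ _ω ∈ (Zd.saws 2 n).filter (fun ω =>
        (∀ i ≤ n, 0 ≤ ω i 0 ∧ ω i 0 ≤ (a : ℤ) ∧ lo ≤ ω i 1 ∧ ω i 1 ≤ hi) ∧ ω n 0 = (a : ℤ)),
        criticalFugacity ^ n ≤
      ∑ _ω ∈ (Zd.bridges 2 (n + 1)).filter (fun ω => ω (n + 1) 0 = (a : ℤ) + 1),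
        criticalFugacity ^ (n + 1) := by
    intro n
    rw [Finset.sum_const, Finset.sum_const, nsmul_eq_mul, nsmul_eq_mul]
    have hcard : (((Zd.saws 2 n).filter (fun ω =>
        (∀ i ≤ n, 0 ≤ ω i 0 ∧ ω i 0 ≤ (a : ℤ) ∧ lo ≤ ω i 1 ∧ ω i 1 ≤ hi) ∧ ω n 0 = (a : ℤ))).card : ℝ) ≤
        (((Zd.bridges 2 (n + 1)).filter (fun ω => ω (n + 1) 0 = (a : ℤ) + 1)).card : ℝ) := by
      norm_cast
      refine Finset.card_le_card_of_injOn (fun ω => Zd.concatWalk 1 (Zd.straightWalk 2 1) ω)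
        (fun ω hω => ?_) (fun ω hω ω' hω' h => ?_)
      · rw [Finset.mem_coe, Finset.mem_filter] at hω ⊢
        obtain ⟨hωs, hb, he⟩ := hω
        have hω0 : ω 0 = 0 := (Zd.mem_saws.1 hωs).1
        refine ⟨Zd.mem_bridges.2 ⟨?_, ?_⟩, ?_⟩
        · rw [add_comm]; exact pre_mem_saws hωs fun j hj => (hb j hj).1
        · rw [add_comm]
          exact pre_isBridge hωs fun j hj => ⟨(hb j hj).1, he ▸ (hb j hj).2.1⟩
        · show Zd.concatWalk 1 (Zd.straightWalk 2 1) ω (n + 1) 0 = ((a + 1 : ℕ) : ℤ)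
          rw [add_comm n 1, pre_apply_one_add_zero hω0, he]
          push_cast
          ring
      · rw [Finset.mem_coe, Finset.mem_filter] at hω hω'
        exact pre_injective (Zd.mem_saws.1 hω.1).1 (Zd.mem_saws.1 hω'.1).1 h
    calc criticalFugacity * ((((Zd.saws 2 n).filter (fun ω =>
          (∀ i ≤ n, 0 ≤ ω i 0 ∧ ω i 0 ≤ (a : ℤ) ∧ lo ≤ ω i 1 ∧ ω i 1 ≤ hi) ∧ ω n 0 = (a : ℤ))).card : ℝ) *
          criticalFugacity ^ n)
        = ((((Zd.saws 2 n).filter (fun ω =>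
          (∀ i ≤ n, 0 ≤ ω i 0 ∧ ω i 0 ≤ (a : ℤ) ∧ lo ≤ ω i 1 ∧ ω i 1 ≤ hi) ∧ ω n 0 = (a : ℤ))).card : ℝ) *
          criticalFugacity ^ (n + 1)) := by ring
      _ ≤ (((Zd.bridges 2 (n + 1)).filter (fun ω => ω (n + 1) 0 = (a : ℤ) + 1)).card : ℝ) *
          criticalFugacity ^ (n + 1) := mul_le_mul_of_nonneg_right hcard (pow_nonneg hx0 _)
  calc criticalFugacity * ∑ n ∈ Finset.range (N + 1), ∑ _ω ∈ (Zd.saws 2 n).filter (fun ω =>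
        (∀ i ≤ n, 0 ≤ ω i 0 ∧ ω i 0 ≤ (a : ℤ) ∧ lo ≤ ω i 1 ∧ ω i 1 ≤ hi) ∧ ω n 0 = (a : ℤ)),
        criticalFugacity ^ n
      = ∑ n ∈ Finset.range (N + 1), criticalFugacity * ∑ _ω ∈ (Zd.saws 2 n).filter (fun ω =>
        (∀ i ≤ n, 0 ≤ ω i 0 ∧ ω i 0 ≤ (a : ℤ) ∧ lo ≤ ω i 1 ∧ ω i 1 ≤ hi) ∧ ω n 0 = (a : ℤ)),
        criticalFugacity ^ n := Finset.mul_sum _ _ _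
    _ ≤ ∑ n ∈ Finset.range (N + 1), ∑ _ω ∈ (Zd.bridges 2 (n + 1)).filter
          (fun ω => ω (n + 1) 0 = (a : ℤ) + 1), criticalFugacity ^ (n + 1) :=
        Finset.sum_le_sum fun n _ => step n
    _ ≤ ∑ n ∈ Finset.range (N + 2), ∑ _ω ∈ (Zd.bridges 2 n).filter (fun ω => ω n 0 = (a : ℤ) + 1),
        criticalFugacity ^ n := by
        rw [Finset.sum_range_succ' (fun n => ∑ _ω ∈ (Zd.bridges 2 n).filter
          (fun ω => ω n 0 = (a : ℤ) + 1), criticalFugacity ^ n) (N + 1)]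
        exact le_add_of_nonneg_right (Finset.sum_nonneg fun _ _ => pow_nonneg hx0 0)

/-- The one-step bridge: the partial bridge mass to the column `x = 1` is `≥ x_c` already at cut-off `1`. -/
theorem criticalFugacity_le_bridgeMass_one :
    criticalFugacity ≤ ∑ n ∈ Finset.range (1 + 1),
      ∑ _ω ∈ (Zd.bridges 2 n).filter (fun ω => ω n 0 = ((1 : ℕ) : ℤ)), criticalFugacity ^ n := by
  have hx0 : 0 ≤ criticalFugacity := criticalFugacity_pos.le
  have hmem : Zd.straightWalk 2 1 ∈ (Zd.bridges 2 1).filter (fun ω => ω 1 0 = ((1 : ℕ) : ℤ)) := by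
    refine Finset.mem_filter.2 ⟨Zd.mem_bridges.2 ⟨Zd.straightWalk_mem_saws 2 1, ?_⟩, by
      simp [Zd.straightWalk]⟩
    intro i h1 h2
    obtain rfl : i = 1 := le_antisymm h2 h1
    simp [Zd.straightWalk]
  calc criticalFugacity = criticalFugacity ^ 1 := (pow_one _).symm
    _ ≤ ∑ _ω ∈ (Zd.bridges 2 1).filter (fun ω => ω 1 0 = ((1 : ℕ) : ℤ)), criticalFugacity ^ 1 :=
        Finset.single_le_sum (f := fun _ => criticalFugacity ^ 1) (fun _ _ => pow_nonneg hx0 1) hmem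
    _ ≤ ∑ n ∈ Finset.range (1 + 1),
          ∑ _ω ∈ (Zd.bridges 2 n).filter (fun ω => ω n 0 = ((1 : ℕ) : ℤ)), criticalFugacity ^ n :=
        Finset.single_le_sum (f := fun n => ∑ _ω ∈ (Zd.bridges 2 n).filter
            (fun ω => ω n 0 = ((1 : ℕ) : ℤ)), criticalFugacity ^ n)
          (fun n _ => Finset.sum_nonneg fun _ _ => pow_nonneg hx0 n) (by simp)

/-- **Hardness link 1 (hypothesis form): S1 implies the pointwise polynomial bridge-by-span floor at `x_c`.**
`CornerCrossingFloor` (the open stub S1 of the line `lieb-simon-star`) implies: there are `C ≥ 0`, `c > 0`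
such that for every `L ≥ 1` some partial sum of the `x_c`-mass of bridges from `0` whose last vertex lies
on the column `x = L` (Madras–Slade's `B_{z_c}(L) = Σ_y B_{z_c}(L, y)`, truncated in the length) is
`≥ c L^{-C}`.  Only `B_{z_c}(L) ≤ 1` and the subexponential bound `B_{z_c}(L) = e^{-o(L)}`
(Madras–Slade Thm 4.1.13, `M(z_c) = 0`) are in print, so S1 is at least as hard as the pointwise
polynomial bridge floor on `ℤ²`. -/
theorem bridgeSpanFloor_of_cornerCrossingFloor' (h : CornerCrossingFloor) :
    ∃ C c : ℝ, 0 ≤ C ∧ 0 < c ∧ ∀ L : ℕ, 1 ≤ L → ∃ N : ℕ,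
      c * (L : ℝ) ^ (-C) ≤ ∑ n ∈ Finset.range (N + 1),
        ∑ _ω ∈ (Zd.bridges 2 n).filter (fun ω => ω n 0 = (L : ℤ)), criticalFugacity ^ n := by
  obtain ⟨K, C, c, hC, hc, hfl⟩ := h
  have hx := criticalFugacity_pos
  set c₁ : ℝ := min c 1 * criticalFugacity with hc₁
  have hc₁pos : 0 < c₁ := mul_pos (lt_min hc one_pos) hx
  refine ⟨C, c₁, hC, hc₁pos, fun L hL => ?_⟩
  have hLpos : (0 : ℝ) < L := by exact_mod_cast hL
  have hLC : (L : ℝ) ^ (-C) ≤ 1 := Real.rpow_le_one_of_one_le_of_nonpos (by exact_mod_cast hL) (by linarith)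
  rcases Nat.lt_or_ge L 2 with hL1 | hL2
  · -- `L = 1`: the one-step bridge
    obtain rfl : L = 1 := by omega
    refine ⟨1, le_trans ?_ criticalFugacity_le_bridgeMass_one⟩
    calc c₁ * ((1 : ℕ) : ℝ) ^ (-C) ≤ c₁ * 1 := mul_le_mul_of_nonneg_left hLC hc₁pos.le
      _ ≤ 1 * criticalFugacity := by
          rw [mul_one, hc₁]; exact mul_le_mul_of_nonneg_right (min_le_right _ _) hx.le
      _ = criticalFugacity := one_mul _
  · -- `L = a + 1` with `a ≥ 1`: prepend an east edge to the corner-crossing walks of width `a`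
    obtain ⟨a, rfl⟩ : ∃ a, L = a + 1 := ⟨L - 1, by omega⟩
    have ha : 1 ≤ a := by omega
    obtain ⟨N, hN⟩ := hfl a ha
    have key := criticalFugacity_mul_boxMass_le_bridgeMass a N 0 ((K : ℤ) * a)
    refine ⟨N + 1, le_trans ?_ (le_trans (mul_le_mul_of_nonneg_left hN hx.le) ?_)⟩
    · -- constants: `c₁ (a+1)^{-C} ≤ x_c · c · a^{-C}`
      have hapos : (0 : ℝ) < a := by exact_mod_cast ha
      have h1 : (((a + 1 : ℕ) : ℝ)) ^ (-C) ≤ (a : ℝ) ^ (-C) :=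
        Real.rpow_le_rpow_of_nonpos hapos (by push_cast; linarith) (by linarith)
      have h2 : 0 ≤ (a : ℝ) ^ (-C) := Real.rpow_nonneg hapos.le _
      calc c₁ * (((a + 1 : ℕ) : ℝ)) ^ (-C) ≤ c₁ * (a : ℝ) ^ (-C) := mul_le_mul_of_nonneg_left h1 hc₁pos.le
        _ ≤ (c * criticalFugacity) * (a : ℝ) ^ (-C) :=
            mul_le_mul_of_nonneg_right (mul_le_mul_of_nonneg_right (min_le_left _ _) hx.le) h2
        _ = criticalFugacity * (c * (a : ℝ) ^ (-C)) := by ring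
    · push_cast at key ⊢
      simpa [add_assoc] using key

/-! ### The crux implies a strip-confined pointwise two-point floor -/

/-- A point within `r` of the segment `[0, (L,0)]` of the real axis has `|y| ≤ r`. -/
theorem abs_im_le_of_infDist_le {L : ℕ} {p : Site 2} {r : ℝ}
    (h : Metric.infDist (Site.toComplex p)
      (segment ℝ (Site.toComplex (0 : Site 2)) (Site.toComplex (![(L : ℤ), 0] : Site 2))) ≤ r) :
    |((p 1 : ℤ) : ℝ)| ≤ r := by
  have toComplex_zero : Site.toComplex (0 : Site 2) = 0 := by
    apply Complex.ext <;> simp [Site.toComplex]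
  have toComplex_axis : Site.toComplex (![(L : ℤ), 0] : Site 2) = (L : ℂ) := by
    apply Complex.ext <;> simp [Site.toComplex]
  have hne : (segment ℝ (Site.toComplex (0 : Site 2)) (Site.toComplex (![(L : ℤ), 0] : Site 2))).Nonempty :=
    ⟨_, left_mem_segment ℝ _ _⟩
  -- for every `ε > 0` some point of the segment is within `r + ε`; its imaginary part is `0`
  refine le_of_forall_pos_lt_add fun ε hε => ?_
  obtain ⟨y, hy, hdy⟩ := (Metric.infDist_lt_iff hne).1 (lt_of_le_of_lt h (lt_add_of_pos_right r hε))
  rw [toComplex_zero, toComplex_axis] at hy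
  obtain ⟨a, b, -, -, -, rfl⟩ := hy
  have him : (a • (0 : ℂ) + b • (L : ℂ)).im = 0 := by simp
  calc |((p 1 : ℤ) : ℝ)| = |(Site.toComplex p).im - (a • (0 : ℂ) + b • (L : ℂ)).im| := by
        rw [him, sub_zero, Site.toComplex_im]
    _ = |(Site.toComplex p - (a • (0 : ℂ) + b • (L : ℂ))).im| := by rw [Complex.sub_im]
    _ ≤ ‖Site.toComplex p - (a • (0 : ℂ) + b • (L : ℂ))‖ := Complex.abs_im_le_norm _
    _ = dist (Site.toComplex p) (a • (0 : ℂ) + b • (L : ℂ)) := (dist_eq_norm _ _).symm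
    _ < r + ε := hdy

/-- **Hardness link 2 (hypothesis form): the crux implies a strip-confined pointwise polynomial two-point floor.**
`TubeLowerBound` implies: there are `C` and `c > 0` such that for every `L ≥ 1` some partial sum of the
`x_c`-mass of self-avoiding walks `0 → (L, 0)` all of whose vertices satisfy `|y| ≤ L/10 + 2` (a horizontal
strip of width `≈ L/5` around the axis — no constraint along the axis) is `≥ c L^{-C}`.  This is a
polynomial lower bound for the critical two-point function of `ℤ²` in the BOUNDARY regime (strip width a
fixed fraction of the distance), for which nothing is in print (Madras–Slade p. 77; the landed
`DominoFloor` is the bulk/fat-domino axis floor). -/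
theorem stripTwoPointFloor_of_tubeLowerBound' (h : TubeLowerBound) :
    ∃ C c : ℝ, 0 < c ∧ ∀ L : ℕ, 1 ≤ L → ∃ N : ℕ,
      c * (L : ℝ) ^ (-C) ≤ ∑ n ∈ Finset.range (N + 1),
        ∑ _ω ∈ (Zd.sawFun 2 n (![(L : ℤ), 0] : Site 2)).filter
          (fun ω => ∀ i ≤ n, |((ω i 1 : ℤ) : ℝ)| ≤ (L : ℝ) / 10 + 2), criticalFugacity ^ n := by
  obtain ⟨C, c, hc, hfl⟩ := h
  refine ⟨C, c, hc, fun L hL => ?_⟩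
  have toComplex_zero : Site.toComplex (0 : Site 2) = 0 := by
    apply Complex.ext <;> simp [Site.toComplex]
  have toComplex_axis : Site.toComplex (![(L : ℤ), 0] : Site 2) = (L : ℂ) := by
    apply Complex.ext <;> simp [Site.toComplex]
  have hdist : dist (Site.toComplex (0 : Site 2)) (Site.toComplex (![(L : ℤ), 0] : Site 2)) ≤ (L : ℝ) := by
    rw [toComplex_zero, toComplex_axis, dist_comm, Complex.dist_eq, sub_zero, Complex.norm_natCast]
  obtain ⟨N, hN⟩ := hfl 0 ![(L : ℤ), 0] L (by exact_mod_cast hL) hdist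
  refine ⟨N, hN.trans (Finset.sum_le_sum fun n _ => ?_)⟩
  refine Finset.sum_le_sum_of_subset_of_nonneg (fun ω hω => ?_)
    fun _ _ _ => pow_nonneg criticalFugacity_pos.le n
  rw [Finset.mem_filter] at hω ⊢
  refine ⟨by simpa using hω.1, fun i hi => ?_⟩
  have := hω.2 i hi
  rw [zero_add] at this
  exact abs_im_le_of_infDist_le this

end Hardness

/-! ### The registered sub-goals (verbatim signatures) -/

/-- **Hardness link 1 (registered sub-goal): `CornerCrossingFloor` ⇒ pointwise polynomial floor for
bridges by span at `x_c`** — for every `L ≥ 1` some partial sum of the `x_c`-mass of bridges from `0` with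
last vertex on the column `x = L` is `≥ c L^{-C}` (`C ≥ 0`, `c > 0`).  In print: `B_{z_c}(L) ≤ 1` and
`B_{z_c}(L) = e^{-o(L)}` only (Madras–Slade Theorem 4.1.13); the polynomial floor is open on `ℤ²`. -/
theorem bridgeSpanFloor_of_cornerCrossingFloor : CornerCrossingFloor → ∃ C c : ℝ, 0 ≤ C ∧ 0 < c ∧
    ∀ L : ℕ, 1 ≤ L → ∃ N : ℕ, c * (L : ℝ) ^ (-C) ≤ ∑ n ∈ Finset.range (N + 1),
      ∑ _ω ∈ (Zd.bridges 2 n).filter (fun ω => ω n 0 = (L : ℤ)), criticalFugacity ^ n :=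
  fun h => Hardness.bridgeSpanFloor_of_cornerCrossingFloor' h

/-- **Hardness link 2 (registered sub-goal): the crux `TubeLowerBound` ⇒ strip-confined pointwise
polynomial two-point floor** — for every `L ≥ 1` some partial sum of the `x_c`-mass of self-avoiding walks
`0 → (L, 0)` with all vertices in the strip `|y| ≤ L/10 + 2` is `≥ c L^{-C}`.  Nothing of this kind is in
print for `ℤ²` (Madras–Slade p. 77: even finiteness of `G_{z_c}(0,x)` is open in `d = 2, 3, 4`). -/
theorem stripTwoPointFloor_of_tubeLowerBound : TubeLowerBound → ∃ C c : ℝ, 0 < c ∧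
    ∀ L : ℕ, 1 ≤ L → ∃ N : ℕ, c * (L : ℝ) ^ (-C) ≤ ∑ n ∈ Finset.range (N + 1),
      ∑ _ω ∈ (Zd.sawFun 2 n (![(L : ℤ), 0] : Site 2)).filter
        (fun ω => ∀ i ≤ n, |((ω i 1 : ℤ) : ℝ)| ≤ (L : ℝ) / 10 + 2), criticalFugacity ^ n :=
  fun h => Hardness.stripTwoPointFloor_of_tubeLowerBound' h

end Summit.CriticalPhenomena.SAWScalingLimit.Theorems.TubeLowerBound.LiebSimonStar

end
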